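import Mathlib

/-!
# Twisted vacuum dominance (finite-dimensional model)
(crux `QuarksAsStableAction.StableActionBridge`, item stmt-QuantumFields-9737, line `Sketch`; lead helper,
`--supports stmt-QuantumFields-9737`; the statement is ideator 2's `TwistedVacuumDominance`, card `twisted-trace-spine`)

Why a bare spectral gap is not enough to pass from the statement's `(−1)^F`-twisted traces on periodic tori to
vacuum expectations: for `T = P + R` with `P` a rank-one orthogonal projection (the vacuum), `R ⪰ 0` with
`P R = 0 = R P` (the rest of the transfer matrix), a unitary `Γ` fixing the vacuum and commuting with `R`, and an
observable `X` with entries of modulus `≤ 1`, the twisted thermal expectation `Tr(Γ Tⁿ X)/Tr(Γ Tⁿ)` is within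
`2 d r/(1 − r)` of the vacuum expectation `Tr(P X)`, where `r = Tr Rⁿ` is the THERMAL ENTROPY SUM, which must be
small (a low-temperature pressure bound), `d` the dimension.  Ingredients: `(P + R)ⁿ = P + Rⁿ` (`n ≥ 1`);
`|Tr(Y S)| ≤ K · Tr S` for `S ⪰ 0` and `‖Y v‖₂ ≤ K ‖v‖₂` (spectral theorem + Cauchy–Schwarz on the eigenvectors);
`‖X v‖₂ ≤ d ‖v‖₂` from the entry bound; `|Tr(Γ Rⁿ)| ≤ Tr Rⁿ`.
-/

namespace Summit.QuantumFields.QCD.Cruxes.StableActionBridge.Sketch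

open scoped ComplexOrder Matrix
open Matrix

/-! ## Cauchy–Schwarz bookkeeping on `Fin d → ℂ` -/

/-- `‖Σ conj(xₐ) yₐ‖ ≤ √(Σ ‖xₐ‖²) · √(Σ ‖yₐ‖²)`. -/
private theorem norm_sum_conj_mul_le {d : ℕ} (x y : Fin d → ℂ) :
    ‖∑ a, (starRingEnd ℂ) (x a) * y a‖ ≤ Real.sqrt (∑ a, ‖x a‖ ^ 2) * Real.sqrt (∑ a, ‖y a‖ ^ 2) := by
  calc ‖∑ a, (starRingEnd ℂ) (x a) * y a‖ ≤ ∑ a, ‖(starRingEnd ℂ) (x a) * y a‖ := norm_sum_le _ _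
    _ = ∑ a, ‖x a‖ * ‖y a‖ := by simp
    _ ≤ Real.sqrt (∑ a, ‖x a‖ ^ 2) * Real.sqrt (∑ a, ‖y a‖ ^ 2) := by
        rw [← Real.sqrt_mul (Finset.sum_nonneg fun _ _ => sq_nonneg _)]
        refine Real.le_sqrt_of_sq_le ?_
        exact Finset.sum_mul_sq_le_sq_mul_sq _ _ _

/-- The columns of a unitary matrix are unit vectors: `Σₐ ‖U a i‖² = 1`. -/
private theorem sum_norm_sq_col_eq_one {d : ℕ} {U : Matrix (Fin d) (Fin d) ℂ}
    (hU : U ∈ Matrix.unitaryGroup (Fin d) ℂ) (i : Fin d) : ∑ a, ‖U a i‖ ^ 2 = 1 := by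
  have h := Matrix.mem_unitaryGroup_iff'.1 hU
  have hii := congrFun (congrFun h i) i
  rw [Matrix.mul_apply, Matrix.one_apply_eq] at hii
  have : (∑ a, ((‖U a i‖ ^ 2 : ℝ) : ℂ)) = 1 := by
    rw [← hii]
    refine Finset.sum_congr rfl fun a _ => ?_
    rw [Matrix.star_apply, Complex.star_def, Complex.conj_mul', Complex.ofReal_pow]
  exact_mod_cast this

/-- A unitary matrix preserves `Σ ‖vₐ‖²`. -/
private theorem sum_norm_sq_unitary_mulVec {d : ℕ} {Γ : Matrix (Fin d) (Fin d) ℂ}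
    (hΓ : Γ ∈ Matrix.unitaryGroup (Fin d) ℂ) (v : Fin d → ℂ) :
    ∑ a, ‖(Γ *ᵥ v) a‖ ^ 2 = ∑ a, ‖v a‖ ^ 2 := by
  have h := Matrix.mem_unitaryGroup_iff'.1 hΓ
  have key : star (Γ *ᵥ v) ⬝ᵥ (Γ *ᵥ v) = star v ⬝ᵥ v := by
    rw [Matrix.star_mulVec, ← Matrix.dotProduct_mulVec, Matrix.mulVec_mulVec]
    change star v ⬝ᵥ ((star Γ * Γ) *ᵥ v) = _
    rw [h, Matrix.one_mulVec]
  have hre : ∀ w : Fin d → ℂ, ((∑ a, ‖w a‖ ^ 2 : ℝ) : ℂ) = star w ⬝ᵥ w := fun w => by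
    simp only [dotProduct, Pi.star_apply, Complex.star_def, Complex.conj_mul', Complex.ofReal_sum,
      Complex.ofReal_pow]
  exact_mod_cast (hre (Γ *ᵥ v)).trans (key.trans (hre v).symm)

/-- Entry bound `‖X i j‖ ≤ 1` gives `Σᵢ ‖(X v)ᵢ‖² ≤ d² Σⱼ ‖vⱼ‖²`. -/
private theorem sum_norm_sq_mulVec_le_of_entry_le {d : ℕ} (X : Matrix (Fin d) (Fin d) ℂ)
    (hX : ∀ i j, ‖X i j‖ ≤ 1) (v : Fin d → ℂ) :
    ∑ i, ‖(X *ᵥ v) i‖ ^ 2 ≤ (d : ℝ) ^ 2 * ∑ j, ‖v j‖ ^ 2 := by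
  have hrow : ∀ i, ‖(X *ᵥ v) i‖ ≤ ∑ j, ‖v j‖ := fun i => by
    rw [Matrix.mulVec, dotProduct]
    refine (norm_sum_le _ _).trans (Finset.sum_le_sum fun j _ => ?_)
    rw [norm_mul]
    exact (mul_le_mul_of_nonneg_right (hX i j) (norm_nonneg _)).trans (one_mul _).le
  have hcs : (∑ j, ‖v j‖) ^ 2 ≤ (d : ℝ) * ∑ j, ‖v j‖ ^ 2 := by
    have h := sq_sum_le_card_mul_sum_sq (s := (Finset.univ : Finset (Fin d))) (f := fun j => ‖v j‖)
    simpa using h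
  calc ∑ i, ‖(X *ᵥ v) i‖ ^ 2 ≤ ∑ _i : Fin d, (d : ℝ) * ∑ j, ‖v j‖ ^ 2 :=
        Finset.sum_le_sum fun i _ =>
          (pow_le_pow_left₀ (norm_nonneg _) (hrow i) 2).trans hcs
    _ = (d : ℝ) ^ 2 * ∑ j, ‖v j‖ ^ 2 := by
        rw [Finset.sum_const, Finset.card_univ, Fintype.card_fin, nsmul_eq_mul]; ring

/-! ## The trace bound `|Tr(Y S)| ≤ K Tr S` for `S ⪰ 0` -/

/-- For `S` positive semidefinite and `Y` with `‖Y v‖₂ ≤ K ‖v‖₂`, `‖Tr(Y S)‖ ≤ K · Re Tr S`. -/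
private theorem norm_trace_mul_posSemidef_le {d : ℕ} (Y S : Matrix (Fin d) (Fin d) ℂ)
    (hS : S.PosSemidef) {K : ℝ} (hK : 0 ≤ K)
    (hY : ∀ v : Fin d → ℂ, ∑ i, ‖(Y *ᵥ v) i‖ ^ 2 ≤ K ^ 2 * ∑ i, ‖v i‖ ^ 2) :
    ‖(Y * S).trace‖ ≤ K * S.trace.re := by
  have hH : S.IsHermitian := hS.1
  set U : Matrix (Fin d) (Fin d) ℂ := (hH.eigenvectorUnitary : Matrix (Fin d) (Fin d) ℂ) with hU
  set D : Matrix (Fin d) (Fin d) ℂ := Matrix.diagonal (RCLike.ofReal ∘ hH.eigenvalues) with hD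
  have hspec : S = U * D * star U := hH.spectral_theorem
  have hUmem : U ∈ Matrix.unitaryGroup (Fin d) ℂ := hH.eigenvectorUnitary.2
  -- `Tr(Y S) = Tr(U† Y U D) = Σ λᵢ (U† Y U)ᵢᵢ`
  have htr : (Y * S).trace = ∑ i, (star U * Y * U) i i * (hH.eigenvalues i : ℂ) := by
    have h1 : (Y * S).trace = (star U * Y * U * D).trace := by
      conv_lhs => rw [hspec]
      rw [← Matrix.mul_assoc, ← Matrix.mul_assoc, Matrix.trace_mul_comm, ← Matrix.mul_assoc,
        ← Matrix.mul_assoc]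
    rw [h1]
    simp only [Matrix.trace, Matrix.diag, hD, Matrix.mul_diagonal, Function.comp_apply, RCLike.ofReal]
    rfl
  -- `(U† Y U)ᵢᵢ = Σₐ conj(Uₐᵢ) (Y uᵢ)ₐ`, bounded by `K`
  have hdiag : ∀ i, ‖(star U * Y * U) i i‖ ≤ K := fun i => by
    have hexp : (star U * Y * U) i i = ∑ a, (starRingEnd ℂ) (U a i) * (Y *ᵥ fun c => U c i) a := by
      rw [Matrix.mul_assoc, Matrix.mul_apply]
      refine Finset.sum_congr rfl fun a _ => ?_
      rw [Matrix.star_apply, Complex.star_def, Matrix.mul_apply, Matrix.mulVec, dotProduct]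
    rw [hexp]
    refine (norm_sum_conj_mul_le _ _).trans ?_
    rw [sum_norm_sq_col_eq_one hUmem i, Real.sqrt_one, one_mul]
    refine (Real.sqrt_le_sqrt (hY _)).trans ?_
    rw [sum_norm_sq_col_eq_one hUmem i, mul_one, Real.sqrt_sq hK]
  -- `Tr S = Σ λᵢ`, `λᵢ ≥ 0`
  have htrS : S.trace.re = ∑ i, hH.eigenvalues i := by
    rw [hH.trace_eq_sum_eigenvalues]; simp
  rw [htr, htrS, Finset.mul_sum]
  refine (norm_sum_le _ _).trans (Finset.sum_le_sum fun i _ => ?_)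
  rw [norm_mul, Complex.norm_real, Real.norm_eq_abs, abs_of_nonneg (hS.eigenvalues_nonneg i)]
  exact mul_le_mul_of_nonneg_right (hdiag i) (hS.eigenvalues_nonneg i)

/-! ## `(P + R)ⁿ = P + Rⁿ` -/

/-- If `P² = P`, `P R = 0 = R P` then `(P + R)^(k+1) = P + R^(k+1)`. -/
private theorem pow_succ_add_of_orthogonal {d : ℕ} (P R : Matrix (Fin d) (Fin d) ℂ) (hPP : P * P = P)
    (hPR : P * R = 0) (hRP : R * P = 0) (k : ℕ) : (P + R) ^ (k + 1) = P + R ^ (k + 1) := by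
  induction k with
  | zero => simp
  | succ k ih =>
      rw [pow_succ, ih, Matrix.add_mul, Matrix.mul_add, Matrix.mul_add, hPP, hPR, add_zero,
        pow_succ R (k + 1)]
      have h0 : R ^ (k + 1) * P = 0 := by rw [pow_succ, Matrix.mul_assoc, hRP, Matrix.mul_zero]
      rw [h0, zero_add]

/-! ## The theorem -/

/-- **Twisted vacuum dominance** (ideator 2's `TwistedVacuumDominance`, verbatim).  For a positive semidefinite
`T = P + R` with `P` a rank-one orthogonal projection (`P² = P`, `Tr P = 1`), `R ⪰ 0`, `P R = 0 = R P`, a unitary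
`Γ` with `Γ P = P`, `Γ R = R Γ`, an observable `X` with `‖X i j‖ ≤ 1`, and `r := Re Tr Rⁿ < 1`:
`‖Tr(Γ Tⁿ X)/Tr(Γ Tⁿ) − Tr(P X)‖ ≤ 2 d r/(1 − r)`. -/
theorem twisted_vacuum_dominance :
    ∀ (d n : ℕ) (P R Γ X : Matrix (Fin d) (Fin d) ℂ), P.PosSemidef → R.PosSemidef →
      P * P = P → P.trace = 1 → P * R = 0 → R * P = 0 →
      Γ ∈ Matrix.unitaryGroup (Fin d) ℂ → Γ * P = P → Γ * R = R * Γ → (∀ i j, ‖X i j‖ ≤ 1) →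
      (R ^ n).trace.re < 1 →
        ‖(Γ * (P + R) ^ n * X).trace / (Γ * (P + R) ^ n).trace - (P * X).trace‖ ≤
          2 * d * (R ^ n).trace.re / (1 - (R ^ n).trace.re) := by
  intro d n P R Γ X hP hR hPP htrP hPR hRP hΓ hΓP _hΓR hX hr
  -- the entropy sum is non-negative
  have hSpsd : (R ^ n).PosSemidef := hR.pow n
  set r : ℝ := (R ^ n).trace.re with hr_def
  have hr0 : 0 ≤ r := by
    have h := hSpsd.trace_nonneg
    rw [RCLike.nonneg_iff] at h
    exact h.1
  cases n with
  | zero =>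
      -- `Tr R⁰ = d < 1` forces `d = 0`: everything is a `0 × 0` trace
      have hd : d = 0 := by
        have h1 : r = d := by
          rw [hr_def, pow_zero, Matrix.trace_one, Fintype.card_fin]; simp
        have : (d : ℝ) < 1 := h1 ▸ hr
        exact_mod_cast Nat.lt_one_iff.1 (by exact_mod_cast this)
      subst hd
      have htr0 : ∀ A : Matrix (Fin 0) (Fin 0) ℂ, A.trace = 0 := fun A => by
        simp [Matrix.trace]
      rw [htr0, htr0, htr0]
      simp only [div_zero, sub_zero, norm_zero, CharP.cast_eq_zero, mul_zero, zero_mul, zero_div, le_refl]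
  | succ k =>
      set S := R ^ (k + 1) with hS_def
      have hpow : (P + R) ^ (k + 1) = P + S := pow_succ_add_of_orthogonal P R hPP hPR hRP k
      -- the three traces
      set t : ℂ := (P * X).trace with ht
      set a : ℂ := (Γ * S * X).trace with ha
      set b : ℂ := (Γ * S).trace with hb
      have hden : (Γ * (P + R) ^ (k + 1)).trace = 1 + b := by
        rw [hpow, Matrix.mul_add, Matrix.trace_add, hΓP, htrP]
      have hnum : (Γ * (P + R) ^ (k + 1) * X).trace = t + a := by
        rw [hpow, Matrix.mul_add, Matrix.add_mul, Matrix.trace_add, hΓP]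
      -- bounds: `‖b‖ ≤ r`, `‖a‖ ≤ d r`, `‖t‖ ≤ d`
      have hXΓ : ∀ v : Fin d → ℂ, ∑ i, ‖((X * Γ) *ᵥ v) i‖ ^ 2 ≤ (d : ℝ) ^ 2 * ∑ i, ‖v i‖ ^ 2 :=
        fun v => by
          rw [← Matrix.mulVec_mulVec]
          exact (sum_norm_sq_mulVec_le_of_entry_le X hX _).trans
            (by rw [sum_norm_sq_unitary_mulVec hΓ v])
      have hΓ1 : ∀ v : Fin d → ℂ, ∑ i, ‖(Γ *ᵥ v) i‖ ^ 2 ≤ (1 : ℝ) ^ 2 * ∑ i, ‖v i‖ ^ 2 :=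
        fun v => by rw [sum_norm_sq_unitary_mulVec hΓ v, one_pow, one_mul]
      have hb_le : ‖b‖ ≤ r := by
        have h := norm_trace_mul_posSemidef_le Γ S hSpsd zero_le_one hΓ1
        rwa [one_mul] at h
      have ha_le : ‖a‖ ≤ d * r := by
        have h := norm_trace_mul_posSemidef_le (X * Γ) S hSpsd (Nat.cast_nonneg d) hXΓ
        rw [← Matrix.trace_mul_cycle] at h
        exact h
      have ht_le : ‖t‖ ≤ d := by
        have hX1 : ∀ v : Fin d → ℂ, ∑ i, ‖(X *ᵥ v) i‖ ^ 2 ≤ (d : ℝ) ^ 2 * ∑ i, ‖v i‖ ^ 2 :=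
          sum_norm_sq_mulVec_le_of_entry_le X hX
        have h := norm_trace_mul_posSemidef_le X P hP (Nat.cast_nonneg d) hX1
        have htrPre : P.trace.re = 1 := by rw [htrP]; simp
        rw [htrPre, mul_one, Matrix.trace_mul_comm] at h
        exact h
      -- algebra
      have hr1 : 0 < 1 - r := by linarith
      have h1b : 1 - r ≤ ‖1 + b‖ := by
        have := norm_sub_norm_le (1 : ℂ) (-b)
        rw [norm_one, norm_neg, sub_neg_eq_add] at this
        linarith
      have h1b_pos : 0 < ‖1 + b‖ := lt_of_lt_of_le hr1 h1b
      have h1b_ne : (1 + b) ≠ 0 := norm_pos_iff.1 h1b_pos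
      rw [hnum, hden]
      have hrewrite : (t + a) / (1 + b) - t = (a - b * t) / (1 + b) := by
        field_simp
        ring
      rw [hrewrite, norm_div]
      rw [div_le_div_iff₀ h1b_pos hr1]
      have hnum_le : ‖a - b * t‖ ≤ d * r + r * d := by
        refine (norm_sub_le _ _).trans (add_le_add ha_le ?_)
        rw [norm_mul]
        exact mul_le_mul hb_le ht_le (norm_nonneg _) hr0
      calc ‖a - b * t‖ * (1 - r) ≤ (d * r + r * d) * (1 - r) :=
            mul_le_mul_of_nonneg_right hnum_le hr1.le
        _ = 2 * d * r * (1 - r) := by ring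
        _ ≤ 2 * d * r * ‖1 + b‖ := by
            refine mul_le_mul_of_nonneg_left h1b ?_
            positivity

end Summit.QuantumFields.QCD.Cruxes.StableActionBridge.Sketch
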